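import Summits.HodgeConjecture.HodgeConjecture.Theorems.F0P6aSpecialPairRecipDatumCentralTwist          -- ★ p849924 (mine): the (S3♯) square with a central factor
import Literature.AlgebraicGeometry.ShimuraVarieties.UnitaryCurveSpecialPairReciprocityCentralTwistAt       -- ★ p849972 (mine, LA6-p02's construction): (S2a) at a GIVEN reflex idèle
import HarnessLib

/-!
# The FORWARD twisted reciprocity law `σ • f[ι₁w, a] = f₂[ι₁w, d♯·a]` at a GIVEN reflex correspondent, for a point map `f₂` with central shadow `ũ_V(1, t(u))`
# ([Milne 2005] Def. 12.8 (62) + Thm. 13.6 with two slices; [Shimura 1998] §18.6; [RSZ 2020] §3.2: the sheets of `M ⊗_F Fᵢ`)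

Cell `hodgecm-mathlib` (D-0151), FLOOR 0, P6 «MOD programme», crux hLiu418 (stmt-HodgeConjecture-24832, `--supports`, count-neutral), line «L4», X-LEAF
`Lines/F0_P6a_EExports.lean` (A-p01 (g28)) socket `stub_ESHEET`, organ map `MEMO-ESHEET-organs.v2` (S3♯) (LA4-plan (g2) DEAL #28 → LA4-p03 (g2)): **the `hfw`
input of ★ `RecordSystemGS.conjSlice_eq_sliceTwo_of_forward_recip` (p849947) PRODUCED from (S2a) + the frame pin + the (S2b) reading**.  THEOREMS ONLY
(no definition, no instance, no named fact, no `sorry`; axioms TRIO).  Chart-generic like ★ `F0P6aSpecialPairRecipDatumCentralTwist`: the Siegel data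
`(𝓜, ιc, unif, u, rep, pts)` with (U3)∕(D3), the curve `(F, ι₁, J⋆)` with `J⋆` hermitian, the auxiliary CM type `Φ ∋ ι₁` and symplectic frame `Fr`, ANY
Hodge-embedding datum `J` with the special-pair property `hJsp` BY VALUE (★ E2), a group map `b` PINNED ON THE FRAME BY VALUE («`b a = ũ_V(a, 1)`», the
`IsChartOfFrame` clause of the chart leaf), a point map `f` with shadow `[J v, b a]` (the chart's `f_pts`), and — the (S2b) reading of the tensored slice
`ψ_𝔞` — a point map `f₂` with shadow `[J v, b a · ũ_V(1, t)]` where `t = N_{E♯,Φ}(u)` is the reflex norm of a GIVEN `E♯`-idèle `u` corresponding to `σ`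
(the (S8) junction pins the central factor at the closer's own correspondent, A-p01 (g28) 2026-09-02).  CONCLUSION: an `F`-correspondent `s′ ↔ σ` along `ι₁`
and a twist `d♯` of `r_w(s′)` with `σ • f[ι₁w, a] = f₂[ι₁w, d♯·a]` for ALL `a` — literally the `{s} hs {d} hd hfw` inputs of ★ p849947 (§2 restates it for
`σL ∈ Aut_F(ℂ)` with `σL|_ℚ`, `F∕ℚ` Galois).  PROOF: ★ `exists_siegelRecipDatum_centralTwist_at` at `u` gives `(c, Φ′, t₀ = t, d♯, s′)` with
`ũ(d♯,t) = cmRecipMatrix`, the split identity `ũ(d♯,t)·ũ(a,1) = ũ(d♯a,1)·ũ(1,t)` — which under the pin IS the central class identity `hS` — and ★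
`smul_f_mk_eq_fTwo_mk_of_cmDatum_central` concludes.
HONEST LABEL: HC_CM is proved only modulo the 2 remaining named inputs (hLiu418 24832, h413 24833) until rung 0 closes; this file is generic and count-neutral.

## References
* [Milne2005ShimuraVarieties] J. S. Milne, *Introduction to Shimura varieties* (2005), Def. 12.8 (59)–(62) p. 114; Thm. 13.6 p. 118; Prop. 14.12 p. 125.
* [Deligne1971TravauxShimura] P. Deligne, *Travaux de Shimura* (1971), Thm. 4.21 p. 152, 5.11 p. 158.
* [Shimura1998] G. Shimura, *Abelian Varieties with Complex Multiplication and Modular Functions* (1998), §18.6 (pp. 124–128).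
* [RapoportSmithlingZhang2020Diagonal] M. Rapoport, B. Smithling, W. Zhang, Compos. Math. 156 (2020), §3.2 p. 11, Remark 3.1 p. 9.
-/

set_option autoImplicit false

noncomputable section

set_option linter.dupNamespace false

namespace Summit.HodgeConjecture.HodgeConjecture.Theorems.F0P6aSpecialPairForwardLawAtCorrespondent

open CategoryTheory AlgebraicGeometry Matrix NumberField IsDedekindDomain
open Literature.AlgebraicGeometry.ModuliOfAbelianVarieties
open Literature.AlgebraicGeometry.ModuliOfAbelianVarieties.SiegelModuli (jOfSiegel jOfSiegel_mem_C0)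
open Literature.AlgebraicGeometry.Motives (SchemeOver ComplexPoints AlgPoints specOver CMType)
open Literature.AlgebraicGeometry.AbelianSchemes (PolarizedAbelianSchemeWithLevel)
open Literature.NumberTheory.Automorphic Literature.NumberTheory.Automorphic.UnitaryGroup
open Literature.NumberTheory.ComplexMultiplication (traceField reflexNormFiniteIdele)
open Literature.AlgebraicGeometry.ShimuraVarieties
open Literature.AlgebraicGeometry.ShimuraVarieties.UnitaryCanonicalModel (IsArtinCorrespondent recipFactor IsDiagTwistGS ShimuraSetGS)
open Literature.AlgebraicGeometry.ShimuraVarieties.UnitaryCanonicalModel.Aux (torusFinAdelic reflexField numberField_reflexField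
  forall_mem_reflexField_apply_eq_of_isGalois)
open Literature.AlgebraicGeometry.ShimuraVarieties.UnitaryCurve
open Literature.AlgebraicGeometry.ShimuraVarieties.UnitaryCurve.AuxV
open Summit.HodgeConjecture.HodgeConjecture.Theorems.F0P6aSpecialPairRecipDatumCentralTwist (smul_f_mk_eq_fTwo_mk_of_cmDatum_central)

/-! ### §1 The forward law at a given reflex correspondent, `σ ∈ Aut(ℂ∕E♯)` -/

/-- **THE FORWARD TWISTED LAW AT A GIVEN CORRESPONDENT** — for `σ ∈ Aut_ℚ(ℂ)` fixing the reflex compositum `E♯ = ι₁(F)·E*(Φ)` and a GIVEN `E♯`-idèle `u ↔ σ`,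
`t : T₀(F)(𝔸_f)` with `t = N_{E♯,Φ}(u)`, a point map `f` with Siegel shadow `[J v, b a]`, `b = ũ_V(·, 1)` pinned on the frame, and a second point map `f₂` with
shadow `[J v, b a · ũ_V(1, t)]`: there are `s′ ↔ σ` along `ι₁` and a twist `d♯` of `r_w(s′)` at the special `w` with **`σ • f[ι₁w, a] = f₂[ι₁w, d♯·a]` for all
`a`**.  (★ `exists_siegelRecipDatum_centralTwist_at` at `u`: its `t₀` equals `t` as both coerce to `N_{E♯,Φ}(u)`; its split identity read through the pin is the
central class identity; ★ `smul_f_mk_eq_fTwo_mk_of_cmDatum_central` with `d := d♯`, `hK := rfl`.)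
[cite: Milne2005ShimuraVarieties, Def. 12.8 (62) p. 114 and Prop. 14.12 p. 125] [cite: Deligne1971TravauxShimura, Thm. 4.21 p. 152 and 5.11 p. 158]
[cite: Shimura1998, §18.6 (pp. 124–128)] -/
theorem exists_forward_law_of_correspondent {g N : ℕ} {δ : Fin g → ℕ} (hg : 0 < g) (hδ : IsPolarizationType δ) (hN : 3 ≤ N)
    (𝓜 : SiegelFineModuliScheme g N δ)
    {Sc : (ZMod N)ˣ → SchemeOver ℂ} (ιc : ∀ c, Sc c ⟶ (Literature.AlgebraicGeometry.Motives.baseChange ℚ ℂ).obj 𝓜.M)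
    (unif : ∀ _c : (ZMod N)ˣ, Matrix (Fin g) (Fin g) ℂ → ComplexPoints (Sc _c))
    {u : (ZMod N)ˣ → finAdeleQˣ} {rep : (ZMod N)ˣ → ↥(gspFinAdelic δ)}
    (hu : ∀ c w, Valued.v ((u c : finAdeleQ) w) = 1)
    (huc : ∀ c, (u c : finAdeleQ) - ((c : ZMod N).val : ℕ) ∈ levelIdeal N)
    (hmult : ∀ c, IsMultiplier (typeFormOver δ finAdeleQ) (rep c : GL (Fin g ⊕ Fin g) finAdeleQ) (u c))
    (hD3 : haveI : IsLocallyNoetherian (specOver ℚ ℂ).left := inferInstanceAs (IsLocallyNoetherian (Spec (CommRingCat.of ℂ)))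
      ∀ (c : (ZMod N)ˣ) (Z : Matrix (Fin g) (Fin g) ℂ) (hZ : Z ∈ siegelUpperHalfSpace g)
        (P' : PolarizedAbelianSchemeWithLevel g N δ (specOver ℚ ℂ).left), IsAdmissibleAt hδ (rep c) Z hZ P' →
          AlgPoints.map (ιc c) (unif c Z) =
            AlgPoints.baseChangeEquiv (algebraMap ℚ ℂ) 𝓜.M (𝓜.classifyingMap (specOver ℚ ℂ) P'))
    (pts : ComplexPoints ((Literature.AlgebraicGeometry.Motives.baseChange ℚ ℂ).obj 𝓜.M) ≃
      SiegelShimuraSet δ (principalLevelSubgroup δ N))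
    (hval : ∀ (c : (ZMod N)ˣ) (W : Matrix (Fin g) (Fin g) ℂ) (hW : W ∈ siegelUpperHalfSpace g),
      pts (AlgPoints.map (ιc c) (unif c W)) =
        SiegelShimuraSet.mk δ (principalLevelSubgroup δ N)
          ⟨jOfSiegel δ W, C0_subset_C0pm δ (jOfSiegel_mem_C0 hδ.1 hW)⟩ (rep c))
    -- the curve, the auxiliary CM type and frame, the Hodge-embedding datum with the special-pair property (E2) by value
    {F : Type} [Field F] [NumberField F] [IsCMField F] (ι₁ : F →+* ℂ) (Jstar : Matrix (Fin 2) (Fin 2) F)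
    (hJ : (Jstar.map (IsCMField.complexConj F))ᵀ = Jstar) (Φ : CMType F) (hΦ : ι₁ ∈ Φ.1) {ξ : F}
    (Fr : SymplecticFrameV F (RingHom.id F) Jstar ξ g δ)
    (J : (Fin 2 → ℂ) → Matrix (Fin g ⊕ Fin g) (Fin g ⊕ Fin g) ℝ)
    (hJC : ∀ v : Fin 2 → ℂ, v ∈ negCone (Jstar.map ι₁) → J v ∈ C0pm δ)
    (hJsp : ∀ (w : Fin 2 → F) (hw : (fun i => ι₁ (w i)) ∈ negCone (Jstar.map ι₁)) (b : GL (Fin 2) F),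
      (fun i => (b : Matrix (Fin 2) (Fin 2) F) i 1) = w →
      Literature.AlgebraicGeometry.ShimuraVarieties.hermForm (cmConjRingHom F) Jstar (fun i => (b : Matrix (Fin 2) (Fin 2) F) i 0) w = 0 →
      ∀ c : CMStructure g δ (Fin 2) (fun _ => F),
        (∀ (x : Fin 2 → F) (p : Fin 2) (m : F),
          c.act x (Fr.β (m • (b : Matrix (Fin 2) (Fin 2) F) *ᵥ Pi.single p 1)) =
            Fr.β ((x p * m) • (b : Matrix (Fin 2) (Fin 2) F) *ᵥ Pi.single p 1)) →
        ∀ Φ' : Fin 2 → CMType F, Φ' 0 = Φ →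
          (∀ ρ : F →+* ℂ, ρ ∈ (Φ' 1).1 ↔ (ρ ∈ Φ.1 ∧ ρ ≠ ι₁) ∨ ρ = NumberField.ComplexEmbedding.conjugate ι₁) →
          c.IsSpecial ⟨J (fun i => ι₁ (w i)), hJC _ hw⟩ Φ')
    -- the level, the group map PINNED on the frame (by value), the point map with its shadow formula
    (K : Subgroup ↥(finAdelic (↥(maximalRealSubfield F)) F (IsCMField.complexConj F) 2 Jstar))
    (b : ↥(finAdelic (↥(maximalRealSubfield F)) F (IsCMField.complexConj F) 2 Jstar) → ↥(gspFinAdelic δ))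
    (hb : ∀ a, b a = auxToGspFinV Fr (a, 1))
    (f : ShimuraSetGS F Jstar ι₁ K → ComplexPoints 𝓜.M)
    (hf : ∀ (v : Fin 2 → ℂ) (hv : v ∈ negCone (Jstar.map ι₁)) (a : ↥(finAdelic (↥(maximalRealSubfield F)) F (IsCMField.complexConj F) 2 Jstar)),
      pts (AlgPoints.baseChangeEquiv (algebraMap ℚ ℂ) 𝓜.M (f (ShimuraSetGS.mk F Jstar ι₁ K v hv a))) =
        SiegelShimuraSet.mk δ (principalLevelSubgroup δ N) ⟨J v, hJC v hv⟩ (b a))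
    -- the automorphism over the reflex compositum
    (σ : ℂ ≃ₐ[ℚ] ℂ) (hσ : ∀ x : ℂ, x ∈ reflexField F Φ ι₁ → σ x = x) :
    haveI : NumberField ↥(reflexField F Φ ι₁) := numberField_reflexField F Φ ι₁
    ∀ (uE : (FiniteAdeleRing (𝓞 ↥(reflexField F Φ ι₁)) ↥(reflexField F Φ ι₁))ˣ),
      IsArtinCorrespondent ↥(reflexField F Φ ι₁) (algebraMap ↥(reflexField F Φ ι₁) ℂ) uE σ.toRingEquiv →
    ∀ t : ↥(torusFinAdelic F), (t : (FiniteAdeleRing (𝓞 F) F)ˣ) = reflexNormFiniteIdele F Φ (reflexField F Φ ι₁) uE →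
    -- the SECOND point map: shadow `[J v, b a · ũ_V(1, t)]` (the tensored slice `ψ_𝔞` of (S2b), central factor `z` with `z·t(sE) = 1` read at `sE⁻¹`, or `t` itself)
    ∀ f₂ : ShimuraSetGS F Jstar ι₁ K → ComplexPoints 𝓜.M,
      (∀ (v : Fin 2 → ℂ) (hv : v ∈ negCone (Jstar.map ι₁)) (a : ↥(finAdelic (↥(maximalRealSubfield F)) F (IsCMField.complexConj F) 2 Jstar)),
        pts (AlgPoints.baseChangeEquiv (algebraMap ℚ ℂ) 𝓜.M (f₂ (ShimuraSetGS.mk F Jstar ι₁ K v hv a))) =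
          SiegelShimuraSet.mk δ (principalLevelSubgroup δ N) ⟨J v, hJC v hv⟩ (b a * auxToGspFinV Fr (1, t))) →
    ∀ (w : Fin 2 → F) (hw : (fun i => ι₁ (w i)) ∈ negCone (Jstar.map ι₁)),
      ∃ (s' : (FiniteAdeleRing (𝓞 F) F)ˣ) (d' : ↥(finAdelic (↥(maximalRealSubfield F)) F (IsCMField.complexConj F) 2 Jstar)),
        IsArtinCorrespondent F ι₁ s' σ.toRingEquiv ∧ IsDiagTwistGS F Jstar w (recipFactor F s') d' ∧
        ∀ a : ↥(finAdelic (↥(maximalRealSubfield F)) F (IsCMField.complexConj F) 2 Jstar),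
          σ • f (ShimuraSetGS.mk F Jstar ι₁ K (fun i => ι₁ (w i)) hw a) = f₂ (ShimuraSetGS.mk F Jstar ι₁ K (fun i => ι₁ (w i)) hw (d' * a)) := by
  haveI : NumberField ↥(reflexField F Φ ι₁) := numberField_reflexField F Φ ι₁
  intro uE hus t ht f₂ hf₂ w hw
  obtain ⟨c, Φ', t₀, d', hsp, -, -, -, hE, hr, ht₀, ⟨s', hs'σ, hd', -⟩, hsplit⟩ :=
    exists_siegelRecipDatum_centralTwist_at ι₁ Jstar hJ Φ hΦ Fr J hJC hJsp uE w hw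
  have htt : t₀ = t := Subtype.ext (ht₀.trans ht.symm)
  subst htt
  refine ⟨s', d', hs'σ σ.toRingEquiv hus, hd', fun a => ?_⟩
  -- the split identity, read through the pin `b = ũ_V(·, 1)`, is the central class identity
  have hS : SiegelShimuraSet.mk δ (principalLevelSubgroup δ N) ⟨J (fun i => ι₁ (w i)), hJC _ hw⟩ (auxToGspFinV Fr (d', t₀) * b a) =
      SiegelShimuraSet.mk δ (principalLevelSubgroup δ N) ⟨J (fun i => ι₁ (w i)), hJC _ hw⟩ (b (d' * a) * auxToGspFinV Fr (1, t₀)) := by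
    rw [hb a, hb (d' * a), hsplit a]
  exact smul_f_mk_eq_fTwo_mk_of_cmDatum_central hg hδ hN 𝓜 ιc unif hu huc hmult hD3 pts hval ι₁ Jstar J hJC K b f hf
    (auxToGspFinV Fr (1, t₀)) f₂ hf₂ σ w hw d' a (reflexField F Φ ι₁) c Φ' uE (auxToGspFinV Fr (d', t₀)) d' hsp hE hσ hus hr hS rfl

/-! ### §2 The same for `σL ∈ Aut_F(ℂ)` (`ℂ` an `F`-algebra through `ι₁`), `F∕ℚ` Galois — the currency of ★ `conjSlice_eq_sliceTwo_of_forward_recip` -/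

/-- **THE FORWARD LAW FOR `σL ∈ Aut(ℂ∕ι₁F)`, `F∕ℚ` GALOIS** — the `{s} hs {d} hd hfw` inputs of ★ `RecordSystemGS.conjSlice_eq_sliceTwo_of_forward_recip`
(p849947) at the chart's point map `f` and the tensored slice's `f₂`: §1 at `σ := σL|_ℚ`, which fixes `E♯ ⊆ ι₁(F)` (★ `forall_mem_reflexField_apply_eq_of_isGalois`).
[cite: Milne2005ShimuraVarieties, Def. 12.8 (62) p. 114, Thm. 13.6 p. 118] [cite: Shimura1998, §8.3 Prop. 28, §18.6 (pp. 124–128)]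
[cite: RapoportSmithlingZhang2020Diagonal, §3.2 p. 11] -/
theorem exists_forward_law_of_correspondent_algEquiv {g N : ℕ} {δ : Fin g → ℕ} (hg : 0 < g) (hδ : IsPolarizationType δ) (hN : 3 ≤ N)
    (𝓜 : SiegelFineModuliScheme g N δ)
    {Sc : (ZMod N)ˣ → SchemeOver ℂ} (ιc : ∀ c, Sc c ⟶ (Literature.AlgebraicGeometry.Motives.baseChange ℚ ℂ).obj 𝓜.M)
    (unif : ∀ _c : (ZMod N)ˣ, Matrix (Fin g) (Fin g) ℂ → ComplexPoints (Sc _c))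
    {u : (ZMod N)ˣ → finAdeleQˣ} {rep : (ZMod N)ˣ → ↥(gspFinAdelic δ)}
    (hu : ∀ c w, Valued.v ((u c : finAdeleQ) w) = 1)
    (huc : ∀ c, (u c : finAdeleQ) - ((c : ZMod N).val : ℕ) ∈ levelIdeal N)
    (hmult : ∀ c, IsMultiplier (typeFormOver δ finAdeleQ) (rep c : GL (Fin g ⊕ Fin g) finAdeleQ) (u c))
    (hD3 : haveI : IsLocallyNoetherian (specOver ℚ ℂ).left := inferInstanceAs (IsLocallyNoetherian (Spec (CommRingCat.of ℂ)))
      ∀ (c : (ZMod N)ˣ) (Z : Matrix (Fin g) (Fin g) ℂ) (hZ : Z ∈ siegelUpperHalfSpace g)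
        (P' : PolarizedAbelianSchemeWithLevel g N δ (specOver ℚ ℂ).left), IsAdmissibleAt hδ (rep c) Z hZ P' →
          AlgPoints.map (ιc c) (unif c Z) =
            AlgPoints.baseChangeEquiv (algebraMap ℚ ℂ) 𝓜.M (𝓜.classifyingMap (specOver ℚ ℂ) P'))
    (pts : ComplexPoints ((Literature.AlgebraicGeometry.Motives.baseChange ℚ ℂ).obj 𝓜.M) ≃
      SiegelShimuraSet δ (principalLevelSubgroup δ N))
    (hval : ∀ (c : (ZMod N)ˣ) (W : Matrix (Fin g) (Fin g) ℂ) (hW : W ∈ siegelUpperHalfSpace g),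
      pts (AlgPoints.map (ιc c) (unif c W)) =
        SiegelShimuraSet.mk δ (principalLevelSubgroup δ N)
          ⟨jOfSiegel δ W, C0_subset_C0pm δ (jOfSiegel_mem_C0 hδ.1 hW)⟩ (rep c))
    {F : Type} [Field F] [NumberField F] [IsCMField F] [IsGalois ℚ F] (ι₁ : F →+* ℂ) (Jstar : Matrix (Fin 2) (Fin 2) F)
    (hJ : (Jstar.map (IsCMField.complexConj F))ᵀ = Jstar) (Φ : CMType F) (hΦ : ι₁ ∈ Φ.1) {ξ : F}
    (Fr : SymplecticFrameV F (RingHom.id F) Jstar ξ g δ)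
    (J : (Fin 2 → ℂ) → Matrix (Fin g ⊕ Fin g) (Fin g ⊕ Fin g) ℝ)
    (hJC : ∀ v : Fin 2 → ℂ, v ∈ negCone (Jstar.map ι₁) → J v ∈ C0pm δ)
    (hJsp : ∀ (w : Fin 2 → F) (hw : (fun i => ι₁ (w i)) ∈ negCone (Jstar.map ι₁)) (b : GL (Fin 2) F),
      (fun i => (b : Matrix (Fin 2) (Fin 2) F) i 1) = w →
      Literature.AlgebraicGeometry.ShimuraVarieties.hermForm (cmConjRingHom F) Jstar (fun i => (b : Matrix (Fin 2) (Fin 2) F) i 0) w = 0 →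
      ∀ c : CMStructure g δ (Fin 2) (fun _ => F),
        (∀ (x : Fin 2 → F) (p : Fin 2) (m : F),
          c.act x (Fr.β (m • (b : Matrix (Fin 2) (Fin 2) F) *ᵥ Pi.single p 1)) =
            Fr.β ((x p * m) • (b : Matrix (Fin 2) (Fin 2) F) *ᵥ Pi.single p 1)) →
        ∀ Φ' : Fin 2 → CMType F, Φ' 0 = Φ →
          (∀ ρ : F →+* ℂ, ρ ∈ (Φ' 1).1 ↔ (ρ ∈ Φ.1 ∧ ρ ≠ ι₁) ∨ ρ = NumberField.ComplexEmbedding.conjugate ι₁) →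
          c.IsSpecial ⟨J (fun i => ι₁ (w i)), hJC _ hw⟩ Φ')
    (K : Subgroup ↥(finAdelic (↥(maximalRealSubfield F)) F (IsCMField.complexConj F) 2 Jstar))
    (b : ↥(finAdelic (↥(maximalRealSubfield F)) F (IsCMField.complexConj F) 2 Jstar) → ↥(gspFinAdelic δ))
    (hb : ∀ a, b a = auxToGspFinV Fr (a, 1))
    (f : ShimuraSetGS F Jstar ι₁ K → ComplexPoints 𝓜.M)
    (hf : ∀ (v : Fin 2 → ℂ) (hv : v ∈ negCone (Jstar.map ι₁)) (a : ↥(finAdelic (↥(maximalRealSubfield F)) F (IsCMField.complexConj F) 2 Jstar)),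
      pts (AlgPoints.baseChangeEquiv (algebraMap ℚ ℂ) 𝓜.M (f (ShimuraSetGS.mk F Jstar ι₁ K v hv a))) =
        SiegelShimuraSet.mk δ (principalLevelSubgroup δ N) ⟨J v, hJC v hv⟩ (b a))
    (σL : letI : Algebra F ℂ := ι₁.toAlgebra; ℂ ≃ₐ[F] ℂ) :
    haveI : NumberField ↥(reflexField F Φ ι₁) := numberField_reflexField F Φ ι₁
    letI : Algebra F ℂ := ι₁.toAlgebra
    ∀ (uE : (FiniteAdeleRing (𝓞 ↥(reflexField F Φ ι₁)) ↥(reflexField F Φ ι₁))ˣ),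
      IsArtinCorrespondent ↥(reflexField F Φ ι₁) (algebraMap ↥(reflexField F Φ ι₁) ℂ) uE σL.toRingEquiv →
    ∀ t : ↥(torusFinAdelic F), (t : (FiniteAdeleRing (𝓞 F) F)ˣ) = reflexNormFiniteIdele F Φ (reflexField F Φ ι₁) uE →
    ∀ f₂ : ShimuraSetGS F Jstar ι₁ K → ComplexPoints 𝓜.M,
      (∀ (v : Fin 2 → ℂ) (hv : v ∈ negCone (Jstar.map ι₁)) (a : ↥(finAdelic (↥(maximalRealSubfield F)) F (IsCMField.complexConj F) 2 Jstar)),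
        pts (AlgPoints.baseChangeEquiv (algebraMap ℚ ℂ) 𝓜.M (f₂ (ShimuraSetGS.mk F Jstar ι₁ K v hv a))) =
          SiegelShimuraSet.mk δ (principalLevelSubgroup δ N) ⟨J v, hJC v hv⟩ (b a * auxToGspFinV Fr (1, t))) →
    ∀ (w : Fin 2 → F) (hw : (fun i => ι₁ (w i)) ∈ negCone (Jstar.map ι₁)),
      ∃ (s' : (FiniteAdeleRing (𝓞 F) F)ˣ) (d' : ↥(finAdelic (↥(maximalRealSubfield F)) F (IsCMField.complexConj F) 2 Jstar)),
        IsArtinCorrespondent F ι₁ s' σL.toRingEquiv ∧ IsDiagTwistGS F Jstar w (recipFactor F s') d' ∧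
        ∀ a : ↥(finAdelic (↥(maximalRealSubfield F)) F (IsCMField.complexConj F) 2 Jstar),
          (σL.restrictScalars ℚ) • f (ShimuraSetGS.mk F Jstar ι₁ K (fun i => ι₁ (w i)) hw a) =
            f₂ (ShimuraSetGS.mk F Jstar ι₁ K (fun i => ι₁ (w i)) hw (d' * a)) := by
  haveI : NumberField ↥(reflexField F Φ ι₁) := numberField_reflexField F Φ ι₁
  letI : Algebra F ℂ := ι₁.toAlgebra
  intro uE hus t ht f₂ hf₂ w hw
  have hσ : ∀ x : ℂ, x ∈ reflexField F Φ ι₁ → (σL.restrictScalars ℚ) x = x :=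
    forall_mem_reflexField_apply_eq_of_isGalois F Φ ι₁ (σL.restrictScalars ℚ) fun x => σL.commutes x
  exact exists_forward_law_of_correspondent hg hδ hN 𝓜 ιc unif hu huc hmult hD3 pts hval ι₁ Jstar hJ Φ hΦ Fr J hJC hJsp K b hb f hf
    (σL.restrictScalars ℚ) hσ uE hus t ht f₂ hf₂ w hw

end Summit.HodgeConjecture.HodgeConjecture.Theorems.F0P6aSpecialPairForwardLawAtCorrespondent

end
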